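import Summits.QuantumFields.YangMills.Theorems.FluctuationComparisonRegPrIntLS2BetaKPLSignMajorant
import Literature.Probability.LatticeModels.PolymerPressure
import Literature.MathematicalPhysics.QuantumFieldTheory.Balaban1983to89.B3Taylor310LocalRemainder
import Literature.MathematicalPhysics.QuantumFieldTheory.Balaban1983to89.B6Prop26ReachTransplant

/-!
# KPL-D · «a Kotecký–Preiss gas represents `log Ξ` as a V-local polymer representation with field-uniform weights» — the stub KPL

Cell `ym3-torus` (rung R3 = continuum SU(2) Yang–Mills on `T³`; NOT `d = 4`, NOT infinite volume, NOT a mass gap, NOT the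
Clay problem), crux `stmt-QuantumFields-20520` (`UnitScaleTilt.FluctuationComparisonRegPrIntL`), LINE g19-1
`Cruxes/FluctuationComparisonRegPrIntL/Lines/largefield_gas.lean` v2 (ideator `ym-r3-idea-1` g19, critic #365 PASS-WITH-PRICE).
TARGET BY TEXT = its abstract, gauge-free stub **KPL `stub_kpLogRep : KPLogRep`** —

  `∀ P W κ N, 0 ≤ κ → ∀ w, KPGasOn W κ N w → PolymerRepOn W κ N (U ↦ log (gasZ w U))`:

a hard-core gas of bond polymers (incompatible iff equal or overlapping, the tree's `polyInc`) whose real, V-LOCAL activities `w_U(X)`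
are dominated ON THE WINDOW `W` by one field-independent Kotecký–Preiss majorant `w̄` (size function `a`, decay `κ·ℓ(X)`, `ℓ(X) ≥` the
source diameter of `X`, pinned size `a{e} ≤ N`) represents `U ↦ log Ξ(w_U)` as a V-local polymer representation on `W` at rate `κ` with
weighted norm `≤ N` ([Balaban1989LargeFieldII] (1.98)–(1.99): «`{⋯} = exp Σ_X 𝐑′(X)`, `𝐑′(X)` depends on `U_k` restricted to `X` and is
exponentially small in `d(X)`»).  We deliver it in HYPOTHESIS FORM and GAUGE-FREE (`polymerRep_of_kpGas`: any field type `Φ`, any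
finite bond type `B`, any `δ : B → B → ℝ` obeying the triangle inequality), then instantiate on `GaugeField P 0 (SU(2))`, `PBond P 0`,
`δ e e' := Site.tdist e.src e'.src` (`kpLogRep`, whose statement is `KPLogRep` with `KPGasOn`/`PolymerRepOn`/`gasZ`/`IsLocal`/
`IsLocalActivity` unfolded token for token — the door-fit is `stub_kpLogRep := kpLogRep` by `δ`-unfolding; `kpLogRep'` is the same with
the `DecidableEq (PBond P 0)` instance as an implicit binder, robust to instance choice).

THE REPRESENTATION (index set = all finite families `C` of polymers, `Fintype.equivFin`):
`supp C := ⋃C` if `C` is a `polyInc`-cluster else `∅`; `act C U := Re Φ^T(w_U; C)` on clusters, `0` else (V-local by `truncatedWeight_congr`;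
non-clusters vanish on `W`, `truncatedWeight_eq_zero_of_kp`); `len C := Σ_{X ∈ C} ℓ X` (≥ the `δ`-diameter of `⋃C` on clusters — the
CHAIN LEMMA `diam_clusterSupp_le_sum`, grow-a-subfamily induction on the cluster property, triangle inequality only); **`wt C := ‖Φ^T(−w̄; C)‖`,
FIELD-UNIFORM by the alternating-sign majorant** (KPL-C `norm_truncatedWeight_le_norm_neg`); pinned bound = the tree's finite-volume
Kotecký–Preiss estimate (4) `ClusterExpansionKPBound.touchSum_le_of_kp` with `d := κℓ` for the activity `−w̄` at the one-bond polymer `{e}`;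
identity `log Re Ξ(w_U) = Re log Ξ = Σ_C Re Φ^T(C)` (KPL-A `log_re_polymerPartitionFunction_of_kp` + [KP86] (2) `polymerLogZ_eq_sum_truncatedWeight`).

Everything is PROVED (0 sorry, no new definitions, no named facts).  HONEST: this closes the M stub KPL of LINE g19-1 BY TEXT; the
line's XL organ LFG (`LargeFieldGasRepCan`, Bałaban's 𝐑-operation for the `T³` tower) stays OPEN, hence so do LFRᶜ, S2β and the crux
`FluctuationComparisonRegPrIntL`; nothing of Bałaban's renormalisation group is asserted here; no summit statement is proved.

References: T. Bałaban, Comm. Math. Phys. 122 (1989) 355–392, (1.98)–(1.99) p.390 [Balaban1989LargeFieldII]; R. Kotecký, D. Preiss,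
Comm. Math. Phys. 103 (1986) 491–498, Theorem p.492 (2),(4) [KoteckyPreiss1986]; A. D. Scott, A. D. Sokal, J. Stat. Phys. 118 (2005), Prop. 2.8
[ScottSokal2005].
-/

noncomputable section

open Finset Filter Topology Set
open scoped BigOperators
open Literature.Probability.LatticeModels
open Summit.QuantumFields.YangMills.Theorems.FluctuationComparisonRegPrIntLS2BetaKPLIncrement
open Summit.QuantumFields.YangMills.Theorems.FluctuationComparisonRegPrIntLS2BetaKPLExpansion
open Summit.QuantumFields.YangMills.Theorems.FluctuationComparisonRegPrIntLS2BetaKPLSignMajorant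

namespace Summit.QuantumFields.YangMills.Theorems.FluctuationComparisonRegPrIntLS2BetaKPLogRep

/-! ## §1 The chain lemma: the diameter of the support of a cluster is at most the sum of the lengths of its members -/

/-- **CHAIN LEMMA.**  If `C` is a cluster for «equal or overlapping» and every member `X` has `δ`-diameter `≤ ℓ X` (`ℓ ≥ 0` on `C`,
`δ` obeying the triangle inequality), then any two points of `⋃ C` are within `Σ_{X ∈ C} ℓ X`: grow a sub-family `R ∋ X₀` one
overlapping member at a time (the cluster property supplies it), keeping `δ(e, ·) ≤ Σ_{X ∈ R} ℓ X` on `⋃ R`. [folklore] -/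
theorem diam_clusterSupp_le_sum {B : Type*} [DecidableEq B] (δ : B → B → ℝ) (hδ : ∀ x y z, δ x z ≤ δ x y + δ y z)
    (ℓ : Finset B → ℝ) {C : Finset (Finset B)} (hCl : IsPolymerCluster polyInc C) (hℓ : ∀ X ∈ C, 0 ≤ ℓ X)
    (hdiam : ∀ X ∈ C, ∀ e ∈ X, ∀ e' ∈ X, δ e e' ≤ ℓ X) :
    ∀ e ∈ clusterSupp C, ∀ e' ∈ clusterSupp C, δ e e' ≤ ∑ X ∈ C, ℓ X := by
  intro e he e' he'
  obtain ⟨X₀, hX₀, heX₀⟩ := mem_clusterSupp.1 he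
  obtain ⟨X₁, hX₁, heX₁⟩ := mem_clusterSupp.1 he'
  -- growing sub-families anchored at `X₀`
  have hgrow : ∀ k : ℕ, 1 ≤ k → k ≤ C.card → ∃ R : Finset (Finset B), R ⊆ C ∧ X₀ ∈ R ∧ R.card = k ∧
      ∀ Y ∈ R, ∀ y ∈ Y, δ e y ≤ ∑ X ∈ R, ℓ X := by
    intro k hk1 hkC
    induction k with
    | zero => exact absurd hk1 (by norm_num)
    | succ k ih =>
      rcases Nat.eq_zero_or_pos k with hk0 | hkpos
      · subst hk0
        refine ⟨{X₀}, Finset.singleton_subset_iff.2 hX₀, Finset.mem_singleton_self X₀, by simp, ?_⟩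
        intro Y hY y hy
        rw [Finset.mem_singleton.1 hY] at hy
        rw [Finset.sum_singleton]
        exact hdiam X₀ hX₀ e heX₀ y hy
      · obtain ⟨R, hRC, hX₀R, hRk, hRb⟩ := ih hkpos (Nat.le_of_succ_le hkC)
        have hRne : R.Nonempty := ⟨X₀, hX₀R⟩
        have hsd : (C \ R).Nonempty := by
          rw [Finset.sdiff_nonempty]
          intro hCR
          have := Finset.card_le_card hCR
          omega
        obtain ⟨Y₁, hY₁, Y₂, hY₂, hinc⟩ := hCl R hRC hRne hsd
        obtain ⟨hY₂C, hY₂R⟩ := Finset.mem_sdiff.1 hY₂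
        rcases hinc with hEq | ⟨b, hb⟩
        · exact absurd (hEq ▸ hY₁) hY₂R
        obtain ⟨hb₁, hb₂⟩ := Finset.mem_inter.1 hb
        refine ⟨insert Y₂ R, Finset.insert_subset hY₂C hRC, Finset.mem_insert_of_mem hX₀R,
          by rw [Finset.card_insert_of_notMem hY₂R, hRk], ?_⟩
        intro Y hY y hy
        rw [Finset.sum_insert hY₂R]
        rcases Finset.mem_insert.1 hY with hYY | hYR
        · subst hYY
          have h1 : δ e b ≤ ∑ X ∈ R, ℓ X := hRb Y₁ hY₁ b hb₁
          have h2 : δ b y ≤ ℓ Y := hdiam Y hY₂C b hb₂ y hy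
          linarith [hδ e b y]
        · have h1 := hRb Y hYR y hy
          linarith [hℓ Y₂ hY₂C]
  have hC1 : 1 ≤ C.card := Finset.card_pos.2 ⟨X₀, hX₀⟩
  obtain ⟨R, hRC, -, hRk, hRb⟩ := hgrow C.card hC1 le_rfl
  have hRCeq : R = C := Finset.eq_of_subset_of_card_le hRC hRk.ge
  rw [hRCeq] at hRb
  exact hRb X₁ hX₁ e' heX₁

/-! ## §2 The generic, gauge-free KPL: a Kotecký–Preiss gas represents `log Ξ` with field-uniform weights -/

/-- A polymer containing the bond `e` touches the one-bond polymer `{e}`. [folklore] -/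
theorem polyInc_singleton_of_mem {B : Type*} [DecidableEq B] {X : Finset B} {e : B} (he : e ∈ X) : polyInc X {e} :=
  Or.inr ⟨e, Finset.mem_inter.2 ⟨he, Finset.mem_singleton_self e⟩⟩

/-- **KPL, GENERIC AND GAUGE-FREE (hypothesis form).**  Fields `U : B → G` on bonds of any finite type `B` with values in any type
`G`, a «distance» `δ` on `B` obeying the triangle inequality.  A family of REAL, V-LOCAL activities `w_U` on the bond polymers (the value at `∅` is
immaterial: `∅` is a polymer incompatible only with itself), dominated on the window `W` by ONE field-independent majorant `w̄` that obeys the Kotecký–Preiss inequality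
`Σ_{X' ι X} w̄(X') e^{a(X') + κℓ(X')} ≤ a(X)` (size `a ≥ 0`, lengths `ℓ(X) ≥` the `δ`-diameter of `X`, `ℓ ≥ 0`, `κ ≥ 0`) with pinned size
`a{e} ≤ N`, represents `U ↦ log Re Ξ(w_U)` on `W` as `c + Σ_i act_i(U)` with V-local `act_i` supported on `supp_i`, FIELD-UNIFORM weights
`|act_i(U)| ≤ wt_i` on `W`, `len_i ≥` the `δ`-diameter of `supp_i`, and `Σ_{i : e ∈ supp_i} wt_i e^{κ len_i} ≤ N` at every bond `e`.
[cite: Balaban1989LargeFieldII, (1.98)-(1.99) p.390; KoteckyPreiss1986, Theorem p.492 (2),(4); ScottSokal2005, Prop. 2.8] -/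
theorem polymerRep_of_kpGas {B G : Type*} [Fintype B] [DecidableEq B] (δ : B → B → ℝ)
    (hδ : ∀ x y z, δ x z ≤ δ x y + δ y z) (W : Set (B → G)) {κ : ℝ} (N : ℝ) (hκ : 0 ≤ κ)
    (w : (B → G) → Finset B → ℝ) (wbar a ℓ : Finset B → ℝ)
    (hloc : ∀ (X : Finset B) (U U' : B → G), (∀ e ∈ X, U e = U' e) → w U X = w U' X)
    (ha : ∀ X, 0 ≤ a X) (hℓ : ∀ X, 0 ≤ ℓ X) (hdom : ∀ U, U ∈ W → ∀ X, |w U X| ≤ wbar X)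
    (hdiam : ∀ X : Finset B, ∀ e ∈ X, ∀ e' ∈ X, δ e e' ≤ ℓ X)
    (hKP : ∀ X : Finset B, ∑ X' ∈ Finset.univ.filter (fun X' => polyInc X' X),
        wbar X' * Real.exp (a X' + κ * ℓ X') ≤ a X)
    (hpin : ∀ e : B, a {e} ≤ N) :
    ∃ (n : ℕ) (supp : Fin n → Finset B) (len wt : Fin n → ℝ) (act : Fin n → (B → G) → ℝ) (c : ℝ),
      (∀ i (U U' : B → G), (∀ e ∈ supp i, U e = U' e) → act i U = act i U') ∧ (∀ i, 0 ≤ wt i) ∧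
      (∀ i, ∀ e ∈ supp i, ∀ e' ∈ supp i, δ e e' ≤ len i) ∧
      (∀ i U, U ∈ W → |act i U| ≤ wt i) ∧
      (∀ e : B, ∑ i ∈ Finset.univ.filter (fun i => e ∈ supp i), wt i * Real.exp (κ * len i) ≤ N) ∧
      ∀ U, U ∈ W → Real.log (polymerPartitionFunction polyInc (fun X : Finset B => ((w U X : ℝ) : ℂ)) Finset.univ).re =
        c + ∑ i, act i U := by
  classical
  rcases Set.eq_empty_or_nonempty W with hW | ⟨U₀, hU₀⟩
  · -- empty window: the empty representation
    refine ⟨0, Fin.elim0, Fin.elim0, Fin.elim0, Fin.elim0, 0, fun i => i.elim0, fun i => i.elim0, fun i => i.elim0,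
      fun i => i.elim0, fun e => ?_, fun U hU => ?_⟩
    · simp only [Finset.univ_eq_empty, Finset.filter_empty, Finset.sum_empty]
      exact (ha {e}).trans (hpin e)
    · rw [hW] at hU; exact absurd hU (Set.notMem_empty U)
  -- nonempty window: the majorant is nonnegative
  have hwbar0 : ∀ X, 0 ≤ wbar X := fun X => (abs_nonneg _).trans (hdom U₀ hU₀ X)
  -- polymers, complex activities, the negative real corner
  set wc : (B → G) → Finset B → ℂ := fun U X => ((w U X : ℝ) : ℂ) with hwc
  set ρ : Finset B → ℂ := fun X => ((-wbar X : ℝ) : ℂ) with hρ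
  set d : Finset B → ℝ := fun X => κ * ℓ X with hd
  have hd0 : ∀ X, 0 ≤ d X := fun X => mul_nonneg hκ (hℓ X)
  -- the finite-volume KP conditions on `L := univ`
  have h1 : ∀ X ∈ (Finset.univ : Finset (Finset B)), ∑ X' ∈ Finset.univ with polyInc X' X,
      ‖ρ X'‖ * Real.exp (a X' + d X') ≤ a X := by
    intro X _
    refine le_trans (le_of_eq (Finset.sum_congr rfl fun X' _ => ?_)) (hKP X)
    simp only [hρ, hd]
    rw [Complex.norm_real, Real.norm_eq_abs, abs_neg, abs_of_nonneg (hwbar0 X')]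
  have hKP0 : IsKPVolume polyInc (fun X => ((wbar X : ℝ) : ℂ)) a (Finset.univ : Finset (Finset B)) := by
    intro X _
    refine le_trans (Finset.sum_le_sum fun X' _ => ?_) (hKP X)
    unfold kpTerm
    rw [Complex.norm_real, Real.norm_eq_abs, abs_of_nonneg (hwbar0 X')]
    refine mul_le_mul_of_nonneg_left (Real.exp_le_exp.2 ?_) (hwbar0 X')
    linarith [mul_nonneg hκ (hℓ X')]
  have hwcle : ∀ U, U ∈ W → ∀ X ∈ (Finset.univ : Finset (Finset B)), ‖wc U X‖ ≤ wbar X := fun U hU X _ => by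
    simp only [hwc]; rw [Complex.norm_real, Real.norm_eq_abs]; exact hdom U hU X
  have hKPU : ∀ U, U ∈ W → IsKPVolume polyInc (wc U) a (Finset.univ : Finset (Finset B)) := fun U hU =>
    isKPVolume_of_norm_le hKP0 hwbar0 (hwcle U hU)
  -- the index set: all finite families of polymers
  set n : ℕ := Fintype.card (Finset (Finset B)) with hn
  set eqv : Finset (Finset B) ≃ Fin n := Fintype.equivFin (Finset (Finset B)) with heqv
  -- the representation, as functions of the family `C`
  set supp' : Finset (Finset B) → Finset B := fun C => if IsPolymerCluster polyInc C then clusterSupp C else ∅ with hsupp'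
  set len' : Finset (Finset B) → ℝ := fun C => ∑ X ∈ C, ℓ X with hlen'
  set wt' : Finset (Finset B) → ℝ := fun C => ‖truncatedWeight polyInc ρ C‖ with hwt'
  set act' : Finset (Finset B) → (B → G) → ℝ := fun C U =>
    if IsPolymerCluster polyInc C then (truncatedWeight polyInc (wc U) C).re else 0 with hact'
  refine ⟨n, fun i => supp' (eqv.symm i), fun i => len' (eqv.symm i), fun i => wt' (eqv.symm i),
    fun i => act' (eqv.symm i), 0, ?_, fun i => norm_nonneg _, ?_, ?_, ?_, ?_⟩
  · -- V-locality
    intro i U U' hUU'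
    simp only [hact', hsupp'] at hUU' ⊢
    split_ifs with hCl
    · rw [if_pos hCl] at hUU'
      congr 1
      refine truncatedWeight_congr fun X hX => ?_
      simp only [hwc]
      rw [hloc X U U' fun e he => hUU' e (subset_clusterSupp hX he)]
    · rfl
  · -- diameters of supports of clusters (chain lemma)
    intro i e he e' he'
    simp only [hsupp', hlen'] at he he' ⊢
    split_ifs at he he' with hCl
    · exact diam_clusterSupp_le_sum δ hδ ℓ hCl (fun X _ => hℓ X) (fun X _ => hdiam X) e he e' he'
    · simp at he
  · -- field-uniform weights (the alternating-sign majorant)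
    intro i U hU
    simp only [hact', hwt']
    split_ifs with hCl
    · exact (Complex.abs_re_le_norm _).trans
        (norm_truncatedWeight_le_norm_neg hwbar0 hKP0 (Finset.subset_univ _) (hwcle U hU))
    · rw [abs_zero]; exact norm_nonneg _
  · -- the pinned bound: finite-volume Kotecký–Preiss (4) for the activity `−w̄`
    intro e
    have hre : ∑ i ∈ Finset.univ.filter (fun i => e ∈ supp' (eqv.symm i)), wt' (eqv.symm i) * Real.exp (κ * len' (eqv.symm i)) =
        ∑ C ∈ Finset.univ.filter (fun C => e ∈ supp' C), wt' C * Real.exp (κ * len' C) := by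
      rw [Finset.sum_filter, Finset.sum_filter]
      exact Equiv.sum_comp eqv.symm (fun C => if e ∈ supp' C then wt' C * Real.exp (κ * len' C) else 0)
    rw [hre]
    have hsub : Finset.univ.filter (fun C => e ∈ supp' C) ⊆
        (Finset.univ : Finset (Finset B)).powerset.filter (fun C => KPTouches polyInc C {e}) := by
      intro C hC
      have heC := (Finset.mem_filter.1 hC).2
      simp only [hsupp'] at heC
      split_ifs at heC with hCl
      · obtain ⟨X, hX, heX⟩ := mem_clusterSupp.1 heC
        exact Finset.mem_filter.2 ⟨Finset.mem_powerset.2 (Finset.subset_univ C), ⟨X, hX, polyInc_singleton_of_mem heX⟩⟩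
      · simp at heC
    have hKP4 := touchSum_le_of_kp (inc := polyInc) (w := ρ) ha hd0 h1 (Finset.mem_univ ({e} : Finset B))
    unfold touchSum at hKP4
    refine le_trans ?_ (hKP4.trans (hpin e))
    refine le_trans (le_of_eq (Finset.sum_congr rfl fun C _ => ?_))
      (Finset.sum_le_sum_of_subset_of_nonneg hsub fun C _ _ => mul_nonneg (norm_nonneg _) (Real.exp_nonneg _))
    simp only [hwt', hlen', hd]
    rw [Finset.mul_sum]
  · -- the identity `log Re Ξ = Σ_C Re Φ^T(C)`
    intro U hU
    rw [zero_add]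
    have hre : ∑ i, act' (eqv.symm i) U = ∑ C, act' C U := Equiv.sum_comp eqv.symm (fun C => act' C U)
    rw [hre]
    have hact : ∀ C : Finset (Finset B), act' C U = (truncatedWeight polyInc (wc U) C).re := by
      intro C
      simp only [hact']
      split_ifs with hCl
      · rfl
      · rw [truncatedWeight_eq_zero_of_kp (hKPU U hU) (Finset.subset_univ C) hCl, Complex.zero_re]
    rw [Finset.sum_congr rfl fun C _ => hact C, ← Complex.re_sum]
    have hsum : ∑ C : Finset (Finset B), truncatedWeight polyInc (wc U) C = polymerLogZ polyInc (wc U) Finset.univ := by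
      rw [polymerLogZ_eq_sum_truncatedWeight, Finset.powerset_univ]
    rw [hsum]
    exact log_re_polymerPartitionFunction_of_kp (f := w U) (hKPU U hU) (Finset.subset_univ _)

/-! ## §3 The SU(2) instance on Bałaban's unit lattice: `KPLogRep` of LINE g19-1, unfolded -/

section SU2

open Literature.MathematicalPhysics.QuantumFieldTheory.Balaban1983to89

/-- The `ℓ¹` torus distance between bond sources obeys the triangle inequality (cast to `ℝ`). [folklore] -/
theorem tdist_src_triangle {P : Params} (e e' e'' : PBond P 0) :
    ((e.src.tdist e''.src : ℕ) : ℝ) ≤ ((e.src.tdist e'.src : ℕ) : ℝ) + ((e'.src.tdist e''.src : ℕ) : ℝ) := by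
  exact_mod_cast B3Taylor310LocalRemainder.tdist_triangle e.src e'.src e''.src

/-- **KPL with the `DecidableEq (PBond P 0)` instance as an implicit binder** (robust door-fit: `fun P W κ N hκ w h => kpLogRep' W κ N hκ w h`).
Statement = `KPLogRep` of LINE g19-1 with `KPGasOn`, `PolymerRepOn`, `gasZ`, `IsLocalActivity`, `IsLocal` unfolded.
[cite: Balaban1989LargeFieldII, (1.98)-(1.99) p.390; KoteckyPreiss1986, Theorem p.492 (2),(4); ScottSokal2005, Prop. 2.8] -/
theorem kpLogRep' {P : Params} {instD : DecidableEq (PBond P 0)}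
    (W : Set (GaugeField P 0 (Matrix.specialUnitaryGroup (Fin 2) ℂ))) (κ N : ℝ) (hκ : 0 ≤ κ)
    (w : GaugeField P 0 (Matrix.specialUnitaryGroup (Fin 2) ℂ) → Finset (PBond P 0) → ℝ)
    (hgas : ∃ (wbar a ℓ : Finset (PBond P 0) → ℝ),
      (∀ U, w U ∅ = 0) ∧
      (∀ (X : Finset (PBond P 0)) (U U' : GaugeField P 0 (Matrix.specialUnitaryGroup (Fin 2) ℂ)),
        (∀ e ∈ X, U e = U' e) → w U X = w U' X) ∧
      (∀ X, 0 ≤ a X) ∧ (∀ X, 0 ≤ ℓ X) ∧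
      (∀ U, U ∈ W → ∀ X, |w U X| ≤ wbar X) ∧
      (∀ X : Finset (PBond P 0), ∀ e ∈ X, ∀ e' ∈ X, (e.src.tdist e'.src : ℝ) ≤ ℓ X) ∧
      (∀ X : Finset (PBond P 0), ∑ X' ∈ Finset.univ.filter (fun X' => polyInc X' X),
          wbar X' * Real.exp (a X' + κ * ℓ X') ≤ a X) ∧
      (∀ e : PBond P 0, a {e} ≤ N)) :
    ∃ (n : ℕ) (supp : Fin n → Finset (PBond P 0)) (len wt : Fin n → ℝ)
      (act : Fin n → GaugeField P 0 (Matrix.specialUnitaryGroup (Fin 2) ℂ) → ℝ) (c : ℝ),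
      (∀ X (U U' : GaugeField P 0 (Matrix.specialUnitaryGroup (Fin 2) ℂ)), (∀ e ∈ supp X, U e = U' e) → act X U = act X U') ∧
      (∀ X, 0 ≤ wt X) ∧
      (∀ X, ∀ e ∈ supp X, ∀ e' ∈ supp X, (e.src.tdist e'.src : ℝ) ≤ len X) ∧
      (∀ X U, U ∈ W → |act X U| ≤ wt X) ∧
      (∀ e : PBond P 0, ∑ X ∈ Finset.univ.filter (fun X => e ∈ supp X), wt X * Real.exp (κ * len X) ≤ N) ∧
      ∀ U, U ∈ W → Real.log ((polymerPartitionFunction polyInc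
        (fun X : Finset (PBond P 0) => ((w U X : ℝ) : ℂ)) Finset.univ).re) = c + ∑ X, act X U := by
  obtain ⟨wbar, a, ℓ, -, hloc, ha, hℓ, hdom, hdiam, hKP, hpin⟩ := hgas
  exact polymerRep_of_kpGas (fun e e' : PBond P 0 => ((e.src.tdist e'.src : ℕ) : ℝ)) tdist_src_triangle W N hκ w wbar a ℓ
    hloc ha hℓ hdom hdiam hKP hpin

open Classical in
/-- **KPL · THE CLUSTER-EXPANSION LEMMA OF LINE g19-1, AS REGISTERED** — `KPLogRep` with its definitions unfolded token for token
(`gasZ w U = Re Ξ(w_U)` over ALL bond polymers with `polyInc`; `KPGasOn`; `PolymerRepOn`): for every lattice `P`, window `W`, rate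
`κ ≥ 0` and size `N`, a Kotecký–Preiss gas on `W` represents `U ↦ log Ξ(w_U)` as a V-local polymer representation on `W` of weighted
norm `≤ N` at rate `κ`.  Door-fit: `theorem stub_kpLogRep : KPLogRep := kpLogRep`. [cite: Balaban1989LargeFieldII, (1.98)-(1.99) p.390; KoteckyPreiss1986, Theorem p.492 (2),(4); ScottSokal2005, Prop. 2.8] -/
theorem kpLogRep :
    ∀ (P : Params) (W : Set (GaugeField P 0 (Matrix.specialUnitaryGroup (Fin 2) ℂ))) (κ N : ℝ), 0 ≤ κ →
      ∀ w : GaugeField P 0 (Matrix.specialUnitaryGroup (Fin 2) ℂ) → Finset (PBond P 0) → ℝ,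
        (∃ (wbar a ℓ : Finset (PBond P 0) → ℝ),
          (∀ U, w U ∅ = 0) ∧
          (∀ (X : Finset (PBond P 0)) (U U' : GaugeField P 0 (Matrix.specialUnitaryGroup (Fin 2) ℂ)),
            (∀ e ∈ X, U e = U' e) → w U X = w U' X) ∧
          (∀ X, 0 ≤ a X) ∧ (∀ X, 0 ≤ ℓ X) ∧
          (∀ U, U ∈ W → ∀ X, |w U X| ≤ wbar X) ∧
          (∀ X : Finset (PBond P 0), ∀ e ∈ X, ∀ e' ∈ X, (e.src.tdist e'.src : ℝ) ≤ ℓ X) ∧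
          (∀ X : Finset (PBond P 0), ∑ X' ∈ Finset.univ.filter (fun X' => polyInc X' X),
              wbar X' * Real.exp (a X' + κ * ℓ X') ≤ a X) ∧
          (∀ e : PBond P 0, a {e} ≤ N)) →
        ∃ (n : ℕ) (supp : Fin n → Finset (PBond P 0)) (len wt : Fin n → ℝ)
          (act : Fin n → GaugeField P 0 (Matrix.specialUnitaryGroup (Fin 2) ℂ) → ℝ) (c : ℝ),
          (∀ X (U U' : GaugeField P 0 (Matrix.specialUnitaryGroup (Fin 2) ℂ)),
              (∀ e ∈ supp X, U e = U' e) → act X U = act X U') ∧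
          (∀ X, 0 ≤ wt X) ∧
          (∀ X, ∀ e ∈ supp X, ∀ e' ∈ supp X, (e.src.tdist e'.src : ℝ) ≤ len X) ∧
          (∀ X U, U ∈ W → |act X U| ≤ wt X) ∧
          (∀ e : PBond P 0, ∑ X ∈ Finset.univ.filter (fun X => e ∈ supp X), wt X * Real.exp (κ * len X) ≤ N) ∧
          ∀ U, U ∈ W → Real.log ((polymerPartitionFunction polyInc
            (fun X : Finset (PBond P 0) => ((w U X : ℝ) : ℂ)) Finset.univ).re) = c + ∑ X, act X U :=
  fun _ W κ N hκ w hgas => kpLogRep' W κ N hκ w hgas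

end SU2

end Summit.QuantumFields.YangMills.Theorems.FluctuationComparisonRegPrIntLS2BetaKPLogRep

end
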